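import Literature.NumberTheory.Irrationality.Fischler2002.Theoreme32OrderFourProofs
import Literature.NumberTheory.Irrationality.Fischler2002.Theoreme32OrbitTwoProofs
import Literature.NumberTheory.Irrationality.Fischler2002.Theoreme32RouteProofs
import HarnessLib

/-!
# Fischler 2002, Théorème 3.2 — brick IX: the Rhin–Viola clause and the invariance of `𝒥/N` for every `n ≥ 5`

Topic `Literature/NumberTheory/Irrationality/Fischler2002`. PROOFS ONLY (no definition, no statement, no discharge of the `∀ n ≥ 2` fact):
for every `n ≥ 5` and any permutations `σ', ψ', φ'` of `{p // InE n p}` with underlying maps `sigma, psi n, phi n`, the two last clauses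
of the typed `theoreme32` HOLD — `IsRhinViolaGroup (fun p => Jn n p.1) ⟨σ',ψ',φ'⟩` (`isRhinViolaGroup_of_five_le`) and, for `g ∈ ⟨σ',ψ',φ'⟩`
and `p, gp` both satisfying the finiteness criterion, `𝒥(gp)/N(gp) = 𝒥(p)/N(p)` (`invariance_of_five_le`) — hence the whole statement of
Théorème 3.2 for `n ≥ 5` (`theoreme32_of_five_le`). PROOF = bricks I–VIII assembled: to `g` is attached a pair `(π, τ)` of permutations of
the two six-orbits of linear forms (brick IV `rel4_*`, brick VIII `relU_*`), an element of the joint group of order 72; `gp` satisfies the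
criterion iff the orbit-2 forms `τ 0`, `τ 3` are non-negative at `p` (cone + `crit_iff_of_cone`); brick VII's kernel-checked ROUTING gives a
word in `σ', ψ', φ'` with the same joint element all of whose right factors are allowed, i.e. a path through criterion points; the word equals
`g` (faithfulness, brick IV `eq_one_of_rel4_one`); brick V's `transport` carries `𝒥/N` along it. [cite: Fischler2002Polyzetas, §3 Théorème 3.2]
[cite: Fischler2003RhinViola, §3.3 Théorème 5, §3.4 Théorème 6] Cell `pub-zeta5`, seat ct-1 g33, 2026-08-28.

HONEST FRAMING (cell pub-zeta5): systematic search; no irrationality claim unless certified — identities between (possibly infinite) integrals of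
non-negative functions and finite bookkeeping; nothing about `ζ(5)`.
-/

noncomputable section

namespace Literature.NumberTheory.Irrationality.Fischler2002

namespace Theoreme32

open Equiv
open scoped ENNReal

section Five

variable {n : ℕ} {f U : Fin 6 → Exponents → ℤ}
  (hf : ∀ (x : Fin 6) (p : Exponents), f x p = ![p.a 1, p.a 2, p.b 2, p.a n, p.a (n - 1), p.c n] x)
  (hU : ∀ (x : Fin 6) (p : Exponents), U x p = ![p.b 3, -p.a 1 + p.a 2 + p.b 3, p.a 1 + p.a 2 - p.a 3, p.b (n - 1),
    p.a (n - 3) - p.a n + p.b (n - 2), p.a (n - 3) + p.b (n - 2) - p.b n] x)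
  {gσ gψ gφ : Perm {p : Exponents // InE n p}}

include hf hU in
/-- **The joint relation along words.** For a word `w` (letters `0 = σ', 1 = ψ', 2 = φ'`), the product `h` of the corresponding generators
carries permutations `π, τ` of the two six-orbits (`f_x ∘ h = f_{πx}`, `U_x ∘ h = U_{τx}`, blocks, middle reversal), and `(π⁻¹, τ⁻¹)` is the
value of `w` in the joint generators of brick VII. [cite: Fischler2002Polyzetas, §3 Théorème 3.2] -/
theorem word_rel (hn : 5 ≤ n) (hσ : ∀ p, (gσ p).1 = sigma p.1) (hψ : ∀ p, (gψ p).1 = psi n p.1) (hφ : ∀ p, (gφ p).1 = phi n p.1)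
    (w : List ℕ) :
    ∃ π τ : Perm (Fin 6),
      ((∀ x p, f x ((w.map fun m => if m = 0 then gσ else if m = 1 then gψ else gφ).prod p).1 = f (π x) p.1) ∧
        (∀ x : Fin 6, (π x).val < 3 ↔ (x.val < 3 ↔ (π 0).val < 3)) ∧
        ∀ (p : {p : Exponents // InE n p}) (k : ℕ), 3 ≤ k → k ≤ n - 2 →
          ((w.map fun m => if m = 0 then gσ else if m = 1 then gψ else gφ).prod p).1.a k =
            p.1.a (if 3 ≤ (π 0).val then n + 1 - k else k)) ∧
      (∀ x p, U x ((w.map fun m => if m = 0 then gσ else if m = 1 then gψ else gφ).prod p).1 = U (τ x) p.1) ∧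
      (w.map fun m : ℕ => if m = 0 then ((swap (0 : Fin 6) 2, swap (1 : Fin 6) 2) : Perm (Fin 6) × Perm (Fin 6))
        else if m = 1 then (swap (0 : Fin 6) 3 * swap (1 : Fin 6) 4 * swap (2 : Fin 6) 5,
          swap (0 : Fin 6) 3 * swap (1 : Fin 6) 4 * swap (2 : Fin 6) 5)
        else (swap (4 : Fin 6) 5, swap (3 : Fin 6) 5)).prod = (π⁻¹, τ⁻¹) := by
  induction w with
  | nil =>
    refine ⟨1, 1, ⟨fun x p => rfl, fun x => by simp, fun p k hk3 hkn => ?_⟩, fun x p => rfl, by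
      simp only [List.map_nil, List.prod_nil, inv_one]; rfl⟩
    simp only [List.map_nil, List.prod_nil, Perm.one_apply, Fin.val_zero, if_neg (show ¬ (3 ≤ 0) by norm_num)]
  | cons m w ih =>
    obtain ⟨π, τ, hrel, hu, hJ⟩ := ih
    by_cases h0 : m = 0
    · refine ⟨π * swap (0 : Fin 6) 2, τ * swap (1 : Fin 6) 2, ?_, ?_, ?_⟩
      · simp only [List.map_cons, List.prod_cons, if_pos h0]
        exact rel4_mul (rel4_sigma hf (by omega) hσ) hrel
      · simp only [List.map_cons, List.prod_cons, if_pos h0]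
        exact relU_mul (relU_sigma hU hn hσ) hu
      · simp only [List.map_cons, List.prod_cons, if_pos h0, hJ, mul_inv_rev, swap_inv]
        rfl
    · by_cases h1 : m = 1
      · refine ⟨π * (swap (0 : Fin 6) 3 * swap (1 : Fin 6) 4 * swap (2 : Fin 6) 5),
          τ * (swap (0 : Fin 6) 3 * swap (1 : Fin 6) 4 * swap (2 : Fin 6) 5), ?_, ?_, ?_⟩
        · simp only [List.map_cons, List.prod_cons, if_neg h0, if_pos h1]
          exact rel4_mul (rel4_psi hf (by omega) hψ) hrel
        · simp only [List.map_cons, List.prod_cons, if_neg h0, if_pos h1]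
          exact relU_mul (relU_psi hU hn hψ) hu
        · have hT : (swap (0 : Fin 6) 3 * swap (1 : Fin 6) 4 * swap (2 : Fin 6) 5)⁻¹ =
              swap (0 : Fin 6) 3 * swap (1 : Fin 6) 4 * swap (2 : Fin 6) 5 := by decide
          simp only [List.map_cons, List.prod_cons, if_neg h0, if_pos h1, hJ, mul_inv_rev, hT]
          rfl
      · refine ⟨π * swap (4 : Fin 6) 5, τ * swap (3 : Fin 6) 5, ?_, ?_, ?_⟩
        · simp only [List.map_cons, List.prod_cons, if_neg h0, if_neg h1]
          exact rel4_mul (rel4_phi hf (by omega) hφ) hrel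
        · simp only [List.map_cons, List.prod_cons, if_neg h0, if_neg h1]
          exact relU_mul (relU_phi hU hn hφ) hu
        · simp only [List.map_cons, List.prod_cons, if_neg h0, if_neg h1, hJ, mul_inv_rev, swap_inv]
          rfl

/-- A product of generators lies in the group. [cite: Fischler2002Polyzetas, §3 Théorème 3.2] -/
theorem word_mem (w : List ℕ) :
    (w.map fun m => if m = 0 then gσ else if m = 1 then gψ else gφ).prod ∈
      Subgroup.closure ({gσ, gψ, gφ} : Set (Perm {p : Exponents // InE n p})) := by
  refine Subgroup.list_prod_mem _ fun g hg => ?_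
  simp only [List.mem_map] at hg
  obtain ⟨m, -, rfl⟩ := hg
  split_ifs <;> exact Subgroup.subset_closure (by simp)

include hf in
/-- **Faithfulness on the first orbit (from brick IV)**: two elements of the group with the same orbit-1 permutation are equal.
[cite: Fischler2002Polyzetas, §3 Théorème 3.2] -/
theorem eq_of_rel4 (hn : 5 ≤ n) (hσ : ∀ p, (gσ p).1 = sigma p.1) (hψ : ∀ p, (gψ p).1 = psi n p.1) (hφ : ∀ p, (gφ p).1 = phi n p.1)
    {g h : Perm {p : Exponents // InE n p}} (hg : g ∈ Subgroup.closure ({gσ, gψ, gφ} : Set (Perm {p : Exponents // InE n p})))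
    (hh : h ∈ Subgroup.closure ({gσ, gψ, gφ} : Set (Perm {p : Exponents // InE n p}))) {π : Perm (Fin 6)}
    (hrg : (∀ x p, f x (g p).1 = f (π x) p.1) ∧ (∀ x : Fin 6, (π x).val < 3 ↔ (x.val < 3 ↔ (π 0).val < 3)) ∧
      ∀ (p : {p : Exponents // InE n p}) (k : ℕ), 3 ≤ k → k ≤ n - 2 → (g p).1.a k = p.1.a (if 3 ≤ (π 0).val then n + 1 - k else k))
    (hrh : (∀ x p, f x (h p).1 = f (π x) p.1) ∧ (∀ x : Fin 6, (π x).val < 3 ↔ (x.val < 3 ↔ (π 0).val < 3)) ∧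
      ∀ (p : {p : Exponents // InE n p}) (k : ℕ), 3 ≤ k → k ≤ n - 2 → (h p).1.a k = p.1.a (if 3 ≤ (π 0).val then n + 1 - k else k)) :
    g = h := by
  have hm := rel4_mul (rel4_inv hrg) hrh
  rw [mul_inv_cancel] at hm
  obtain ⟨h1, -, h3⟩ := hm
  have key := eq_one_of_rel4_one hf (by omega) hσ hψ hφ (Subgroup.mul_mem _ (Subgroup.inv_mem _ hg) hh)
    (fun x p => by rw [h1 x p, Perm.one_apply]) (fun p k hk3 hkn => by
      rw [h3 p k hk3 hkn, Perm.one_apply, Fin.val_zero, if_neg (by norm_num)])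
  rw [inv_mul_eq_one] at key
  exact key

include hf hU in
/-- **The joint element of a group element** (`n ≥ 5`): permutations `π, τ` of the two six-orbits with the relations of bricks IV and VIII,
`(π, τ)` in the joint group of brick VII. [cite: Fischler2002Polyzetas, §3 Théorème 3.2] -/
theorem exists_joint_of_mem (hn : 5 ≤ n) (hσ : ∀ p, (gσ p).1 = sigma p.1) (hψ : ∀ p, (gψ p).1 = psi n p.1)
    (hφ : ∀ p, (gφ p).1 = phi n p.1) {g : Perm {p : Exponents // InE n p}}
    (hg : g ∈ Subgroup.closure ({gσ, gψ, gφ} : Set (Perm {p : Exponents // InE n p}))) :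
    ∃ π τ : Perm (Fin 6),
      (π, τ) ∈ Subgroup.closure ({((swap (0 : Fin 6) 2, swap (1 : Fin 6) 2) : Perm (Fin 6) × Perm (Fin 6)),
        (swap (0 : Fin 6) 3 * swap (1 : Fin 6) 4 * swap (2 : Fin 6) 5, swap (0 : Fin 6) 3 * swap (1 : Fin 6) 4 * swap (2 : Fin 6) 5),
        (swap (4 : Fin 6) 5, swap (3 : Fin 6) 5)} : Set (Perm (Fin 6) × Perm (Fin 6))) ∧
      ((∀ x p, f x (g p).1 = f (π x) p.1) ∧ (∀ x : Fin 6, (π x).val < 3 ↔ (x.val < 3 ↔ (π 0).val < 3)) ∧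
        ∀ (p : {p : Exponents // InE n p}) (k : ℕ), 3 ≤ k → k ≤ n - 2 →
          (g p).1.a k = p.1.a (if 3 ≤ (π 0).val then n + 1 - k else k)) ∧
      (∀ x p, U x (g p).1 = U (τ x) p.1) := by
  induction hg using Subgroup.closure_induction with
  | mem x hx =>
    simp only [Set.mem_insert_iff, Set.mem_singleton_iff] at hx
    rcases hx with rfl | rfl | rfl
    · exact ⟨_, _, Subgroup.subset_closure (by simp), rel4_sigma hf (by omega) hσ, relU_sigma hU hn hσ⟩
    · exact ⟨_, _, Subgroup.subset_closure (by simp), rel4_psi hf (by omega) hψ, relU_psi hU hn hψ⟩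
    · exact ⟨_, _, Subgroup.subset_closure (by simp), rel4_phi hf (by omega) hφ, relU_phi hU hn hφ⟩
  | one =>
    refine ⟨1, 1, Subgroup.one_mem _, ⟨fun x p => rfl, fun x => by simp, fun p k hk3 hkn => ?_⟩, fun x p => rfl⟩
    rw [Perm.one_apply, Perm.one_apply, Fin.val_zero, if_neg (by norm_num)]
  | mul x y _ _ ihx ihy =>
    obtain ⟨π, τ, hm, hr, hu⟩ := ihx
    obtain ⟨π', τ', hm', hr', hu'⟩ := ihy
    exact ⟨π' * π, τ' * τ, by simpa using Subgroup.mul_mem _ hm' hm, rel4_mul hr hr', relU_mul hu hu'⟩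
  | inv x _ ihx =>
    obtain ⟨π, τ, hm, hr, hu⟩ := ihx
    exact ⟨π⁻¹, τ⁻¹, by simpa using Subgroup.inv_mem _ hm, rel4_inv hr, relU_inv hu⟩

include hU in
/-- **Criterion along the orbit**: for `h` in the group with orbit-2 permutation `τ` and `p` in the cone, `hp` satisfies the criterion
iff the forms `u_{τ 0}`, `u_{τ 3}` are non-negative at `p`. [cite: Fischler2002Polyzetas, §3 Théorème 3.2] -/
theorem crit_iff_tau (hn : 5 ≤ n) (hσ : ∀ p, (gσ p).1 = sigma p.1) (hψ : ∀ p, (gψ p).1 = psi n p.1)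
    (hφ : ∀ p, (gφ p).1 = phi n p.1) {h : Perm {p : Exponents // InE n p}} {τ : Perm (Fin 6)}
    (hh : h ∈ Subgroup.closure ({gσ, gψ, gφ} : Set (Perm {p : Exponents // InE n p})))
    (hu : ∀ x p, U x (h p).1 = U (τ x) p.1) (p : {p : Exponents // InE n p})
    (hK : (∀ k ∈ Finset.Icc 1 n, 0 ≤ p.1.a k) ∧ 0 ≤ p.1.b 2 ∧ 0 ≤ p.1.b n ∧ ∀ k, 4 ≤ k → k ≤ n - 2 → 0 ≤ p.1.b k) :
    FinitenessCriterionGen n (h p).1 ↔ 0 ≤ U (τ 0) p.1 ∧ 0 ≤ U (τ 3) p.1 := by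
  rw [crit_iff_of_cone hn (h p).2 (cone_of_mem hn hσ hψ hφ hh p hK), ← hu 0 p, ← hu 3 p, hU, hU]
  rfl

/-- The four sign bits of `b = ε₁ + 2ε₂ + 4ε₄ + 8ε₅`. [cite: Fischler2002Polyzetas, §3 Théorème 3.2] -/
theorem bits_spec (P₁ P₂ P₄ P₅ : Prop) [Decidable P₁] [Decidable P₂] [Decidable P₄] [Decidable P₅] :
    (if P₁ then 1 else 0) + (if P₂ then 2 else 0) + (if P₄ then 4 else 0) + (if P₅ then 8 else 0) < 16 ∧
    (((if P₁ then 1 else 0) + (if P₂ then 2 else 0) + (if P₄ then 4 else 0) + (if P₅ then 8 else 0)) % 2 = 1 ↔ P₁) ∧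
    (((if P₁ then 1 else 0) + (if P₂ then 2 else 0) + (if P₄ then 4 else 0) + (if P₅ then 8 else 0)) / 2 % 2 = 1 ↔ P₂) ∧
    (((if P₁ then 1 else 0) + (if P₂ then 2 else 0) + (if P₄ then 4 else 0) + (if P₅ then 8 else 0)) / 4 % 2 = 1 ↔ P₄) ∧
    (((if P₁ then 1 else 0) + (if P₂ then 2 else 0) + (if P₄ then 4 else 0) + (if P₅ then 8 else 0)) / 8 % 2 = 1 ↔ P₅) := by
  by_cases h1 : P₁ <;> by_cases h2 : P₂ <;> by_cases h4 : P₄ <;> by_cases h5 : P₅ <;> simp [h1, h2, h4, h5]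

include hf hU in
/-- **Invariance of `𝒥/N` for `n ≥ 5`.** For `g ∈ ⟨σ', ψ', φ'⟩` and `p ∈ 𝓔` with `p` and `gp` in the finiteness criterion,
`𝒥(gp)/N(gp) = 𝒥(p)/N(p)`. [cite: Fischler2002Polyzetas, §3 Théorème 3.2 (« il laisse stable 𝒥(p)/(a_{n−1}! b_{n−1}! a₂! b₃!) si n ≥ 5 »)]
[cite: Fischler2003RhinViola, §3.3 Théorème 5] -/
theorem invariance_of_five_le_aux (hn : 5 ≤ n) (hσ : ∀ p, (gσ p).1 = sigma p.1) (hψ : ∀ p, (gψ p).1 = psi n p.1)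
    (hφ : ∀ p, (gφ p).1 = phi n p.1) {g : Perm {p : Exponents // InE n p}}
    (hg : g ∈ Subgroup.closure ({gσ, gψ, gφ} : Set (Perm {p : Exponents // InE n p}))) (p : {p : Exponents // InE n p})
    (hc : FinitenessCriterionGen n p.1) (hcg : FinitenessCriterionGen n (g p).1) :
    Jn n (g p).1 / (rvNormaliser n (g p).1 : ℝ≥0∞) = Jn n p.1 / (rvNormaliser n p.1 : ℝ≥0∞) := by
  obtain ⟨π, τ, hmem, hr, hu⟩ := exists_joint_of_mem hf hU hn hσ hψ hφ hg
  -- the cone and the criterion at `p`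
  have hK : (∀ k ∈ Finset.Icc 1 n, 0 ≤ p.1.a k) ∧ 0 ≤ p.1.b 2 ∧ 0 ≤ p.1.b n ∧ ∀ k, 4 ≤ k → k ≤ n - 2 → 0 ≤ p.1.b k :=
    ⟨hc.1, hc.2.1 2 (Finset.mem_Icc.2 ⟨by norm_num, by omega⟩), hc.2.1 n (Finset.mem_Icc.2 ⟨by omega, le_rfl⟩),
      fun k hk4 hkn => hc.2.1 k (Finset.mem_Icc.2 ⟨by omega, by omega⟩)⟩
  have hb3 : 0 ≤ U 0 p.1 := by rw [hU]; exact hc.2.1 3 (Finset.mem_Icc.2 ⟨by norm_num, by omega⟩)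
  have hbm : 0 ≤ U 3 p.1 := by rw [hU]; exact hc.2.1 (n - 1) (Finset.mem_Icc.2 ⟨by omega, by omega⟩)
  -- the sign pattern of the orbit-2 forms at `p`
  obtain ⟨b, hbdef⟩ : ∃ b : ℕ, b = (if U 1 p.1 < 0 then 1 else 0) + (if U 2 p.1 < 0 then 2 else 0) +
      (if U 4 p.1 < 0 then 4 else 0) + (if U 5 p.1 < 0 then 8 else 0) := ⟨_, rfl⟩
  obtain ⟨hb16, e1, e2, e4, e5⟩ := bits_spec (U 1 p.1 < 0) (U 2 p.1 < 0) (U 4 p.1 < 0) (U 5 p.1 < 0)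
  rw [← hbdef] at hb16 e1 e2 e4 e5
  have link : ∀ y : Fin 6, ¬ ((y = 1 ∧ b % 2 = 1) ∨ (y = 2 ∧ b / 2 % 2 = 1) ∨ (y = 4 ∧ b / 4 % 2 = 1) ∨
      (y = 5 ∧ b / 8 % 2 = 1)) ↔ 0 ≤ U y p.1 := by
    intro y
    rw [e1, e2, e4, e5]
    fin_cases y <;> simp [hb3, hbm, not_lt]
  -- routing
  have hal := (crit_iff_tau hU hn hσ hψ hφ hg hu p hK).1 hcg
  have hal' : ¬ ((((π, τ)⁻¹ : Perm (Fin 6) × Perm (Fin 6)).2.symm 0 = 1 ∧ b % 2 = 1) ∨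
      (((π, τ)⁻¹ : Perm (Fin 6) × Perm (Fin 6)).2.symm 0 = 2 ∧ b / 2 % 2 = 1) ∨
      (((π, τ)⁻¹ : Perm (Fin 6) × Perm (Fin 6)).2.symm 0 = 4 ∧ b / 4 % 2 = 1) ∨
      (((π, τ)⁻¹ : Perm (Fin 6) × Perm (Fin 6)).2.symm 0 = 5 ∧ b / 8 % 2 = 1)) ∧
      ¬ ((((π, τ)⁻¹ : Perm (Fin 6) × Perm (Fin 6)).2.symm 3 = 1 ∧ b % 2 = 1) ∨
      (((π, τ)⁻¹ : Perm (Fin 6) × Perm (Fin 6)).2.symm 3 = 2 ∧ b / 2 % 2 = 1) ∨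
      (((π, τ)⁻¹ : Perm (Fin 6) × Perm (Fin 6)).2.symm 3 = 4 ∧ b / 4 % 2 = 1) ∨
      (((π, τ)⁻¹ : Perm (Fin 6) × Perm (Fin 6)).2.symm 3 = 5 ∧ b / 8 % 2 = 1)) := by
    have e : ((π, τ)⁻¹ : Perm (Fin 6) × Perm (Fin 6)).2.symm = τ := by
      rw [Prod.inv_mk]; exact Equiv.symm_symm τ
    rw [e]
    exact ⟨(link _).2 hal.1, (link _).2 hal.2⟩
  obtain ⟨w, -, hwprod, hpath⟩ := route b hb16 (π, τ)⁻¹ (Subgroup.inv_mem _ hmem) hal'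
  -- the group word and its joint element
  obtain ⟨π', τ', hr', hu', hJ⟩ := word_rel hf hU hn hσ hψ hφ w
  rw [hwprod, Prod.inv_mk, Prod.mk.injEq, inv_inj, inv_inj] at hJ
  obtain ⟨rfl, rfl⟩ := hJ
  have hwg : (w.map fun m => if m = 0 then gσ else if m = 1 then gψ else gφ).prod = g :=
    (eq_of_rel4 hf hn hσ hψ hφ hg (word_mem w) hr hr').symm
  -- the path stays inside the criterion
  have hpath' : ∀ k, k ≤ (w.map fun m => if m = 0 then gσ else if m = 1 then gψ else gφ).length →
      FinitenessCriterionGen n ((((w.map fun m => if m = 0 then gσ else if m = 1 then gψ else gφ).drop k).prod p).1) := by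
    intro k hk
    rw [← List.map_drop]
    obtain ⟨πk, τk, -, huk, hJk⟩ := word_rel hf hU hn hσ hψ hφ (w.drop k)
    have hak := hpath k (by simpa using hk)
    have e : (((w.drop k).map fun m : ℕ => if m = 0 then ((swap (0 : Fin 6) 2, swap (1 : Fin 6) 2) : Perm (Fin 6) × Perm (Fin 6))
        else if m = 1 then (swap (0 : Fin 6) 3 * swap (1 : Fin 6) 4 * swap (2 : Fin 6) 5,
          swap (0 : Fin 6) 3 * swap (1 : Fin 6) 4 * swap (2 : Fin 6) 5)
        else (swap (4 : Fin 6) 5, swap (3 : Fin 6) 5)).prod).2.symm = τk := by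
      rw [hJk]; exact Equiv.symm_symm τk
    rw [e] at hak
    exact (crit_iff_tau hU hn hσ hψ hφ (word_mem (w.drop k)) huk p hK).2 ⟨(link _).1 hak.1, (link _).1 hak.2⟩
  -- transport
  have ht := transport (by omega) hσ hψ hφ (w.map fun m => if m = 0 then gσ else if m = 1 then gψ else gφ)
    (fun g' hg' => by
      simp only [List.mem_map] at hg'
      obtain ⟨m, -, rfl⟩ := hg'
      split_ifs <;> simp) p hpath'
  rwa [hwg] at ht

end Five

/-- **Invariance of `𝒥/N` for every `n ≥ 5`** (hypotheses-free form: the tables are introduced inside).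
[cite: Fischler2002Polyzetas, §3 Théorème 3.2] [cite: Fischler2003RhinViola, §3.3 Théorème 5] -/
theorem invariance_of_five_le {n : ℕ} (hn : 5 ≤ n) {gσ gψ gφ : Perm {p : Exponents // InE n p}}
    (hσ : ∀ p, (gσ p).1 = sigma p.1) (hψ : ∀ p, (gψ p).1 = psi n p.1) (hφ : ∀ p, (gφ p).1 = phi n p.1)
    {g : Perm {p : Exponents // InE n p}} (hg : g ∈ Subgroup.closure ({gσ, gψ, gφ} : Set (Perm {p : Exponents // InE n p})))
    (p : {p : Exponents // InE n p}) (hc : FinitenessCriterionGen n p.1) (hcg : FinitenessCriterionGen n (g p).1) :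
    Jn n (g p).1 / (rvNormaliser n (g p).1 : ℝ≥0∞) = Jn n p.1 / (rvNormaliser n p.1 : ℝ≥0∞) := by
  obtain ⟨f, hf⟩ : ∃ f : Fin 6 → Exponents → ℤ, ∀ (x : Fin 6) (p : Exponents),
      f x p = ![p.a 1, p.a 2, p.b 2, p.a n, p.a (n - 1), p.c n] x := ⟨_, fun _ _ => rfl⟩
  obtain ⟨U, hU⟩ : ∃ U : Fin 6 → Exponents → ℤ, ∀ (x : Fin 6) (p : Exponents),
      U x p = ![p.b 3, -p.a 1 + p.a 2 + p.b 3, p.a 1 + p.a 2 - p.a 3, p.b (n - 1),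
        p.a (n - 3) - p.a n + p.b (n - 2), p.a (n - 3) + p.b (n - 2) - p.b n] x := ⟨_, fun _ _ => rfl⟩
  exact invariance_of_five_le_aux hf hU hn hσ hψ hφ hg p hc hcg

/-- **The Rhin–Viola property for every `n ≥ 5`**: `⟨σ', ψ', φ'⟩` is a Rhin–Viola group for `(𝒥(p))_{p ∈ 𝓔}` in the typed sense — whenever
`𝒥(p)` and `𝒥(gp)` are finite their ratio is the rational number `N(gp)/N(p)`. [cite: Fischler2002Polyzetas, §3 Théorème 3.2]
[cite: Fischler2003RhinViola, §3.3 Théorème 5] -/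
theorem isRhinViolaGroup_of_five_le {n : ℕ} (hn : 5 ≤ n) {gσ gψ gφ : Perm {p : Exponents // InE n p}}
    (hσ : ∀ p, (gσ p).1 = sigma p.1) (hψ : ∀ p, (gψ p).1 = psi n p.1) (hφ : ∀ p, (gφ p).1 = phi n p.1) :
    IsRhinViolaGroup (fun p : {p : Exponents // InE n p} => Jn n p.1)
      (Subgroup.closure ({gσ, gψ, gφ} : Set (Perm {p : Exponents // InE n p}))) := by
  intro g hg p hp hgp
  have hc : FinitenessCriterionGen n p.1 := (Jn_finite_iff_holds n p.1 (by omega)).1 hp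
  have hcg : FinitenessCriterionGen n (g p).1 := (Jn_finite_iff_holds n (g p).1 (by omega)).1 hgp
  have ht := invariance_of_five_le hn hσ hψ hφ hg p hc hcg
  have hN := rvNormaliser_pos n p.1
  have hN' := rvNormaliser_pos n (g p).1
  refine ⟨(rvNormaliser n (g p).1 : ℚ) / rvNormaliser n p.1, ?_⟩
  have hcast : (((rvNormaliser n (g p).1 : ℚ) / rvNormaliser n p.1 : ℚ) : ℝ) =
      (rvNormaliser n (g p).1 : ℝ) / (rvNormaliser n p.1 : ℝ) := by push_cast; rfl
  rw [hcast, ENNReal.ofReal_div_of_pos (by exact_mod_cast hN), ENNReal.ofReal_natCast, ENNReal.ofReal_natCast]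
  rw [ENNReal.div_eq_div_iff (by exact_mod_cast hN.ne') (ENNReal.natCast_ne_top _) (by exact_mod_cast hN'.ne')
    (ENNReal.natCast_ne_top _)] at ht
  calc Jn n (g p).1 = (rvNormaliser n (g p).1 : ℝ≥0∞) * Jn n p.1 / (rvNormaliser n p.1 : ℝ≥0∞) :=
        (ENNReal.eq_div_iff (by exact_mod_cast hN.ne') (ENNReal.natCast_ne_top _)).2 ht
    _ = (rvNormaliser n (g p).1 : ℝ≥0∞) / (rvNormaliser n p.1 : ℝ≥0∞) * Jn n p.1 := by
        rw [mul_comm (rvNormaliser n (g p).1 : ℝ≥0∞), mul_div_assoc, mul_comm]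

/-- **Fischler 2002, Théorème 3.2 for every `n ≥ 5` — ALL CLAUSES** (the `n ≥ 5` case of the named fact `theoreme32`, as typed): the
restricted permutations exist, generate a Rhin–Viola group for `(𝒥(p))_{p∈𝓔}` of order `72 = rvGroupOrder n`, and leave `𝒥(p)/N(p)` invariant
on pairs in the criterion. [cite: Fischler2002Polyzetas, §3 Théorème 3.2] [cite: Fischler2003RhinViola, §3.3 Théorème 5, §3.4 Théorème 6] -/
theorem theoreme32_of_five_le (n : ℕ) (hn : 5 ≤ n) :
    ∃ σ' ψ' φ' : Equiv.Perm {p : Exponents // InE n p},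
      (∀ p, (σ' p).1 = sigma p.1) ∧ (∀ p, (ψ' p).1 = psi n p.1) ∧ (∀ p, (φ' p).1 = phi n p.1) ∧
      IsRhinViolaGroup (fun p => Jn n p.1)
        (Subgroup.closure ({σ', ψ', φ'} : Set (Equiv.Perm {p : Exponents // InE n p}))) ∧
      Nat.card (Subgroup.closure ({σ', ψ', φ'} : Set (Equiv.Perm {p : Exponents // InE n p}))) =
        rvGroupOrder n ∧
      ∀ g ∈ Subgroup.closure ({σ', ψ', φ'} : Set (Equiv.Perm {p : Exponents // InE n p})),
        ∀ p : {p : Exponents // InE n p},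
          FinitenessCriterionGen n p.1 → FinitenessCriterionGen n (g p).1 →
            Jn n (g p).1 / (rvNormaliser n (g p).1 : ℝ≥0∞) = Jn n p.1 / (rvNormaliser n p.1 : ℝ≥0∞) := by
  obtain ⟨σ', ψ', φ', hσ, hψ, hφ⟩ := exists_perms (n := n) (by omega)
  exact ⟨σ', ψ', φ', hσ, hψ, hφ, isRhinViolaGroup_of_five_le hn hσ hψ hφ, card_closure_eq (by omega) hσ hψ hφ,
    fun g hg p hc hcg => invariance_of_five_le hn hσ hψ hφ hg p hc hcg⟩

end Theoreme32

end Literature.NumberTheory.Irrationality.Fischler2002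

end
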